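import Literature.NumberTheory.Automorphic.IdeleClassGroupProofs
import Mathlib.Analysis.Normed.Group.Ultra
import Mathlib.Analysis.SpecialFunctions.Pow.NNReal
import Mathlib.Data.Matrix.Mul
import HarnessLib

/-!
# Heights of adelic vectors
(Godement, *Domaines fondamentaux des groupes arithmétiques*, Sém. Bourbaki 257 (1962/63), §1.1;
Garrett, *Modern Analysis of Automorphic Forms by Example* (2018), §2.2 (PDF pp. 81–82) and
§3.3 (PDF p. 162))

The height machinery of Minkowski reduction for `GL_n` over a number field `K` (towards the
discharge of `reductionTheory_gl`, Getz–Hahn (2024), Thm. 2.7.2): for a vector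
`x = (xᵢ)_{i ∈ ι} ∈ 𝔸_K^ι` (row vectors, `GL_n(𝔸_K)` acting on the right by `Matrix.vecMul`),

* `vecFinHeight K v x = maxᵢ |xᵢ|_v ∈ ℝ≥0` — the local height at a finite place `v` (sup norm,
  Godement §1.2 "maximum of the absolute values of the coordinates", Garrett
  `h_v(x) = sup |xᵢ|_v`);
* `vecArchNorm K w x = (∑ᵢ |xᵢ|_w²)^{1/2}` — the Euclidean norm at an infinite place `w` (with
  Mathlib's norm on the completion `K_w`, i.e. the usual absolute value of `ℝ` or `ℂ`); the local
  height there is `vecArchNorm K w x ^ mult w` (`mult = 1` real, `2` complex: Garrett's "square of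
  the usual complex Hilbert-space norm, to not disturb the product formula");
* `vecHeight K x = ∏_{w ∣ ∞} vecArchNorm K w x ^ mult w · ∏ᶠ_v vecFinHeight K v x ∈ ℝ≥0` — the
  global height (Mathlib `finprod` over the finite places; meaningful when `IsHeightFinite K x`:
  all but finitely many finite local heights are `1`, which holds for the *primitive* vectors
  `ξ g`, `ξ ∈ Kⁿ ∖ 0`, `g ∈ GL_n(𝔸_K)`, of Godement and Garrett: `isHeightFinite_principalVec_vecMul`).

Proved here (everything; no named facts): scaling by an idele multiplies the height by the idele
norm (`vecHeight_smul`, Godement §1.1 (v)), hence **invariance under `Kˣ`** (product formula,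
`vecHeight_smul_algebraMap`); the height of a vector with a single non-zero idele coordinate is
the idele norm of that coordinate (`vecHeight_single`); extension by zero does not change heights
(`vecHeight_extend`); rational non-zero vectors have height `≥ 1` (`one_le_vecHeight_principalVec`);
the ultrametric bound `vecFinHeight K v (x ᵥ* M) ≤ maxᵢⱼ |Mᵢⱼ|_v · vecFinHeight K v x` and the
resulting **invariance of the finite local heights under `GL_n(𝒪_v)`**
(`vecFinHeight_vecMul_eq_of_forall_mem`); height-finiteness of `ξ g`.

## References

* R. Godement, *Domaines fondamentaux des groupes arithmétiques*, Sém. Bourbaki 257 (1962/63),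
  §1.1 (heights (i)–(vi)), §1.2 (the canonical height); English translation in
  Borel–Godement–Siegel–Weil, *Arithmetic groups and reduction theory* (2020), PDF pp. 156–158.
* P. Garrett, *Modern Analysis of Automorphic Forms by Example* (2018), §2.2 (PDF pp. 81–82),
  §3.3 (PDF p. 162) [Garrett2018].
-/

noncomputable section

open scoped NNReal Matrix
open NumberField IsDedekindDomain

namespace Literature.NumberTheory.Automorphic

section Defs

variable (K : Type) [Field K] [NumberField K] {ι : Type*} [Fintype ι]

/-- The **local height at a finite place** `v` of an adelic vector `x ∈ 𝔸_K^ι`: the sup norm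
`maxᵢ |xᵢ|_v` of its `v`-components (Godement, Sém. Bourbaki 257, §1.2; Garrett (2018), §2.2,
`h_v(x) = sup |xᵢ|_v`). Junk value `0` for an empty index type. [cite: Garrett2018, §2.2 (PDF p. 81)] -/
def vecFinHeight (v : HeightOneSpectrum (𝓞 K)) (x : ι → AdeleRing (𝓞 K) K) : ℝ≥0 :=
  Finset.univ.sup fun i => ‖(x i).2 v‖₊

/-- The **Euclidean norm at an infinite place** `w` of an adelic vector `x ∈ 𝔸_K^ι`:
`(∑ᵢ |xᵢ|_w²)^{1/2}` for Mathlib's norm on the completion `K_w` (the usual absolute value of `ℝ`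
or `ℂ`); the local height at `w` is its `mult w`-th power (Garrett (2018), §2.2: the Hilbert-space
norm at real places and its square at complex places). [cite: Garrett2018, §2.2 (PDF p. 81)] -/
def vecArchNorm (w : InfinitePlace K) (x : ι → AdeleRing (𝓞 K) K) : ℝ≥0 :=
  NNReal.sqrt (∑ i, ‖(x i).1 w‖₊ ^ 2)

/-- The **global height** of an adelic vector:
`h(x) = ∏_{w ∣ ∞} vecArchNorm K w x ^ mult w · ∏ᶠ_v vecFinHeight K v x` (Godement §1.1,
`‖x‖ = ∏_p ‖x_p‖_p`; Garrett §2.2, `h(x) = ∏_v h_v(x)`), the finite part as a `finprod` (the junk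
value `1` if infinitely many finite local heights differ from `1`, which does not happen for
primitive vectors, `isHeightFinite_principalVec_vecMul`). [cite: Garrett2018, §2.2 (PDF p. 81)] -/
def vecHeight (x : ι → AdeleRing (𝓞 K) K) : ℝ≥0 :=
  (∏ w : InfinitePlace K, vecArchNorm K w x ^ w.mult) * ∏ᶠ v, vecFinHeight K v x

/-- An adelic vector has **finite height data** if all but finitely many of its finite local
heights are `1` (true for primitive vectors `ξ g`, `ξ ∈ Kⁿ ∖ 0`; Garrett (2018), §2.2: "for all
but finitely many `v` the local height is `1`, and the infinite product is a finite product").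
[cite: Garrett2018, §2.2 (PDF p. 82)] -/
def IsHeightFinite (x : ι → AdeleRing (𝓞 K) K) : Prop :=
  (fun v => vecFinHeight K v x).HasFiniteMulSupport

end Defs

section PrincipalVec

variable (K : Type) [Field K] [NumberField K] {ι : Type*}

/-- The rational vector `ξ ∈ K^ι` as an adelic vector (diagonal embedding coordinatewise).
[folklore] -/
def principalVec (ξ : ι → K) : ι → AdeleRing (𝓞 K) K := fun i => algebraMap K (AdeleRing (𝓞 K) K) (ξ i)

variable {K} in
/-- `principalVec` coordinatewise (definitional). [folklore] -/
@[simp]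
theorem principalVec_apply (ξ : ι → K) (i : ι) :
    principalVec K ξ i = algebraMap K (AdeleRing (𝓞 K) K) (ξ i) := rfl

variable {K} in
/-- Components of a product of adeles at an infinite place. [folklore] -/
theorem AdeleRing.mul_fst_apply (a b : AdeleRing (𝓞 K) K) (w : InfinitePlace K) :
    (a * b).1 w = a.1 w * b.1 w := rfl

variable {K} in
/-- Components of a product of adeles at a finite place. [folklore] -/
theorem AdeleRing.mul_snd_apply (a b : AdeleRing (𝓞 K) K) (v : HeightOneSpectrum (𝓞 K)) :
    (a * b).2 v = a.2 v * b.2 v := rfl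

/-- Components of the zero adele at an infinite place. [folklore] -/
theorem AdeleRing.zero_fst_apply (w : InfinitePlace K) : (0 : AdeleRing (𝓞 K) K).1 w = 0 := rfl

/-- Components of the zero adele at a finite place. [folklore] -/
theorem AdeleRing.zero_snd_apply (v : HeightOneSpectrum (𝓞 K)) :
    (0 : AdeleRing (𝓞 K) K).2 v = 0 := rfl

end PrincipalVec

section Basic

variable {K : Type} [Field K] [NumberField K] {ι : Type*} [Fintype ι]

/-- A coordinate is bounded by the finite local height. [folklore] -/
theorem nnnorm_snd_apply_le_vecFinHeight (v : HeightOneSpectrum (𝓞 K)) (x : ι → AdeleRing (𝓞 K) K)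
    (i : ι) : ‖(x i).2 v‖₊ ≤ vecFinHeight K v x :=
  Finset.le_sup (f := fun i => ‖(x i).2 v‖₊) (Finset.mem_univ i)

/-- A coordinate is bounded by the Euclidean norm at an infinite place. [folklore] -/
theorem nnnorm_fst_apply_le_vecArchNorm (w : InfinitePlace K) (x : ι → AdeleRing (𝓞 K) K)
    (i : ι) : ‖(x i).1 w‖₊ ≤ vecArchNorm K w x := by
  rw [vecArchNorm, ← NNReal.sqrt_sq ‖(x i).1 w‖₊]
  exact NNReal.sqrt_le_sqrt.mpr
    (Finset.single_le_sum (f := fun i => ‖(x i).1 w‖₊ ^ 2) (fun _ _ => bot_le)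
      (Finset.mem_univ i))

/-- The finite local height is bounded by any common bound of the coordinates. [folklore] -/
theorem vecFinHeight_le {v : HeightOneSpectrum (𝓞 K)} {x : ι → AdeleRing (𝓞 K) K} {C : ℝ≥0}
    (h : ∀ i, ‖(x i).2 v‖₊ ≤ C) : vecFinHeight K v x ≤ C :=
  Finset.sup_le fun i _ => h i

/-! ### Scaling by ideles and invariance under `Kˣ` -/

/-- Scaling by an adele scales the finite local heights: `h_v(a x) = |a|_v h_v(x)`. [folklore] -/
theorem vecFinHeight_smul (v : HeightOneSpectrum (𝓞 K)) (a : AdeleRing (𝓞 K) K)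
    (x : ι → AdeleRing (𝓞 K) K) :
    vecFinHeight K v (a • x) = ‖a.2 v‖₊ * vecFinHeight K v x := by
  rw [vecFinHeight, vecFinHeight, NNReal.mul_finset_sup]
  refine Finset.sup_congr rfl fun i _ => ?_
  rw [Pi.smul_apply, smul_eq_mul, AdeleRing.mul_snd_apply, nnnorm_mul]

/-- Scaling by an adele scales the Euclidean norms: `‖a x‖_w = |a|_w ‖x‖_w`. [folklore] -/
theorem vecArchNorm_smul (w : InfinitePlace K) (a : AdeleRing (𝓞 K) K)
    (x : ι → AdeleRing (𝓞 K) K) :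
    vecArchNorm K w (a • x) = ‖a.1 w‖₊ * vecArchNorm K w x := by
  rw [vecArchNorm, vecArchNorm, ← NNReal.sqrt_sq ‖a.1 w‖₊, ← NNReal.sqrt_mul, Finset.mul_sum]
  congr 1
  refine Finset.sum_congr rfl fun i _ => ?_
  rw [Pi.smul_apply, smul_eq_mul, AdeleRing.mul_fst_apply, nnnorm_mul, mul_pow]

/-- Height-finiteness is preserved by scaling by an idele. [folklore] -/
theorem IsHeightFinite.smul {x : ι → AdeleRing (𝓞 K) K} (hx : IsHeightFinite K x)
    (a : (AdeleRing (𝓞 K) K)ˣ) : IsHeightFinite K ((a : AdeleRing (𝓞 K) K) • x) := by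
  have h : (fun v => vecFinHeight K v ((a : AdeleRing (𝓞 K) K) • x)) =
      (fun v => ‖(a : AdeleRing (𝓞 K) K).2 v‖₊) * fun v => vecFinHeight K v x := by
    funext v
    rw [Pi.mul_apply, vecFinHeight_smul]
  rw [IsHeightFinite, h]
  exact ((hasFiniteMulSupport_nnnorm K a).union hx).subset (Function.mulSupport_mul _ _)

/-- **Scaling by an idele multiplies the height by the idele norm**: `h(a x) = |a|_𝔸 h(x)` for an
idele `a` and a vector with finite height data (Godement, Sém. Bourbaki 257, §1.1 (v):
"`‖tx‖ = |t| · ‖x‖` for every `t ∈ A*`"). [cite: Garrett2018, §2.2 (PDF p. 81)] -/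
theorem vecHeight_smul {x : ι → AdeleRing (𝓞 K) K} (hx : IsHeightFinite K x)
    (a : (AdeleRing (𝓞 K) K)ˣ) :
    vecHeight K ((a : AdeleRing (𝓞 K) K) • x) = IdeleClassGroup.ideleNorm K a * vecHeight K x := by
  rw [vecHeight, vecHeight, ideleNorm_apply]
  simp_rw [vecArchNorm_smul, vecFinHeight_smul, mul_pow, Finset.prod_mul_distrib]
  rw [finprod_mul_distrib (hasFiniteMulSupport_nnnorm K a) hx]
  ring

/-- **The height is invariant under `Kˣ`** (product formula): `h(κ x) = h(x)` for `κ ∈ Kˣ`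
(Garrett (2018), §2.2: "good behavior under scalar multiplication, via the product formula").
[cite: Garrett2018, §2.2 (PDF p. 81)] -/
theorem vecHeight_smul_algebraMap {x : ι → AdeleRing (𝓞 K) K} (hx : IsHeightFinite K x) (κ : Kˣ) :
    vecHeight K (algebraMap K (AdeleRing (𝓞 K) K) κ • x) = vecHeight K x := by
  have h := vecHeight_smul hx (Units.map (algebraMap K (AdeleRing (𝓞 K) K) : K →* _) κ)
  rw [Units.coe_map] at h
  rw [show ((algebraMap K (AdeleRing (𝓞 K) K) : K →* AdeleRing (𝓞 K) K) (κ : K)) =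
    algebraMap K (AdeleRing (𝓞 K) K) κ from rfl] at h
  rw [h, ideleNorm_principal ⟨κ, rfl⟩, one_mul]

/-! ### Vectors with a single non-zero coordinate, and extension by zero -/

/-- The finite local heights of a vector with a single (possibly) non-zero coordinate `a` are the
`|a|_v`. [folklore] -/
theorem vecFinHeight_single [DecidableEq ι] (v : HeightOneSpectrum (𝓞 K)) (i₀ : ι)
    (a : AdeleRing (𝓞 K) K) : vecFinHeight K v (Pi.single i₀ a) = ‖a.2 v‖₊ := by
  refine le_antisymm (vecFinHeight_le fun i => ?_) ?_
  · by_cases hi : i = i₀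
    · subst hi; rw [Pi.single_eq_same]
    · rw [Pi.single_eq_of_ne hi, AdeleRing.zero_snd_apply, nnnorm_zero]
      exact bot_le
  · have h := nnnorm_snd_apply_le_vecFinHeight v (Pi.single i₀ a : ι → AdeleRing (𝓞 K) K) i₀
    rwa [Pi.single_eq_same] at h

/-- The Euclidean norms of a vector with a single (possibly) non-zero coordinate `a` are the
`|a|_w`. [folklore] -/
theorem vecArchNorm_single [DecidableEq ι] (w : InfinitePlace K) (i₀ : ι) (a : AdeleRing (𝓞 K) K) :
    vecArchNorm K w (Pi.single i₀ a) = ‖a.1 w‖₊ := by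
  rw [vecArchNorm, Finset.sum_eq_single i₀, Pi.single_eq_same, NNReal.sqrt_sq]
  · intro i _ hi
    rw [Pi.single_eq_of_ne hi, AdeleRing.zero_fst_apply, nnnorm_zero, zero_pow two_ne_zero]
  · exact fun h => absurd (Finset.mem_univ i₀) h

/-- A vector with a single non-zero idele coordinate has finite height data. [folklore] -/
theorem isHeightFinite_single [DecidableEq ι] (i₀ : ι) (a : (AdeleRing (𝓞 K) K)ˣ) :
    IsHeightFinite K (Pi.single i₀ (a : AdeleRing (𝓞 K) K)) := by
  have h : (fun v => vecFinHeight K v (Pi.single i₀ (a : AdeleRing (𝓞 K) K))) =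
      fun v => ‖(a : AdeleRing (𝓞 K) K).2 v‖₊ := funext fun v => vecFinHeight_single v i₀ _
  rw [IsHeightFinite, h]
  exact hasFiniteMulSupport_nnnorm K a

/-- **The height of a vector with a single non-zero idele coordinate is the idele norm of that
coordinate**: `h(0, …, 0, a, 0, …, 0) = |a|_𝔸` (Garrett (2018), §2.2: `h((0 1) g) = |d|` for
upper triangular `g`). [cite: Garrett2018, §2.2 (PDF p. 82)] -/
theorem vecHeight_single [DecidableEq ι] (i₀ : ι) (a : (AdeleRing (𝓞 K) K)ˣ) :
    vecHeight K (Pi.single i₀ (a : AdeleRing (𝓞 K) K)) = IdeleClassGroup.ideleNorm K a := by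
  rw [vecHeight, ideleNorm_apply]
  simp_rw [vecArchNorm_single, vecFinHeight_single]

/-- **Extension by zero does not change heights** (finite places): if `y ∈ 𝔸_K^κ` agrees with
`x ∈ 𝔸_K^ι` along an injection `e : ι → κ` and vanishes off its range, then `h_v(y) = h_v(x)`.
[folklore] -/
theorem vecFinHeight_extend {κ : Type*} [Fintype κ] (v : HeightOneSpectrum (𝓞 K))
    {x : ι → AdeleRing (𝓞 K) K} {y : κ → AdeleRing (𝓞 K) K} {e : ι → κ}
    (hy : ∀ i, y (e i) = x i) (hy0 : ∀ k, k ∉ Set.range e → y k = 0) :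
    vecFinHeight K v y = vecFinHeight K v x := by
  refine le_antisymm (vecFinHeight_le fun k => ?_) (vecFinHeight_le fun i => ?_)
  · by_cases hk : k ∈ Set.range e
    · obtain ⟨i, rfl⟩ := hk
      rw [hy i]
      exact nnnorm_snd_apply_le_vecFinHeight v x i
    · rw [hy0 k hk, AdeleRing.zero_snd_apply, nnnorm_zero]
      exact bot_le
  · rw [← hy i]
    exact nnnorm_snd_apply_le_vecFinHeight v y (e i)

/-- **Extension by zero does not change heights** (infinite places). [folklore] -/
theorem vecArchNorm_extend {κ : Type*} [Fintype κ] (w : InfinitePlace K)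
    {x : ι → AdeleRing (𝓞 K) K} {y : κ → AdeleRing (𝓞 K) K} {e : ι → κ} (he : Function.Injective e)
    (hy : ∀ i, y (e i) = x i) (hy0 : ∀ k, k ∉ Set.range e → y k = 0) :
    vecArchNorm K w y = vecArchNorm K w x := by
  classical
  rw [vecArchNorm, vecArchNorm]
  congr 1
  have h1 : ∑ k, ‖(y k).1 w‖₊ ^ 2 = ∑ k ∈ Finset.univ.image e, ‖(y k).1 w‖₊ ^ 2 := by
    refine (Finset.sum_subset (Finset.subset_univ _) fun k _ hk => ?_).symm
    have hk' : k ∉ Set.range e := fun ⟨i, hi⟩ => hk (Finset.mem_image.mpr ⟨i, Finset.mem_univ i, hi⟩)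
    rw [hy0 k hk', AdeleRing.zero_fst_apply, nnnorm_zero, zero_pow two_ne_zero]
  rw [h1, Finset.sum_image fun i _ j _ h => he h]
  exact Finset.sum_congr rfl fun i _ => by rw [hy i]

/-- **Extension by zero does not change the global height.** [folklore] -/
theorem vecHeight_extend {κ : Type*} [Fintype κ] {x : ι → AdeleRing (𝓞 K) K}
    {y : κ → AdeleRing (𝓞 K) K} {e : ι → κ} (he : Function.Injective e)
    (hy : ∀ i, y (e i) = x i) (hy0 : ∀ k, k ∉ Set.range e → y k = 0) :
    vecHeight K y = vecHeight K x := by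
  rw [vecHeight, vecHeight]
  simp_rw [vecArchNorm_extend _ he hy hy0, vecFinHeight_extend _ hy hy0]

/-- Height-finiteness is invariant under extension by zero. [folklore] -/
theorem isHeightFinite_extend_iff {κ : Type*} [Fintype κ] {x : ι → AdeleRing (𝓞 K) K}
    {y : κ → AdeleRing (𝓞 K) K} {e : ι → κ}
    (hy : ∀ i, y (e i) = x i) (hy0 : ∀ k, k ∉ Set.range e → y k = 0) :
    IsHeightFinite K y ↔ IsHeightFinite K x := by
  rw [IsHeightFinite, IsHeightFinite]
  simp_rw [vecFinHeight_extend _ hy hy0]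

/-! ### The ultrametric bound under matrices, and invariance under `GL_n(𝒪_v)` -/

/-- **Ultrametric bound for the action of a matrix**: at a finite place,
`h_v(x M) ≤ (maxᵢⱼ |Mᵢⱼ|_v) · h_v(x)` (an entry of `x M` is a sum of products `xᵢ Mᵢⱼ`).
[folklore] -/
theorem vecFinHeight_vecMul_le {κ : Type*} [Fintype κ] (v : HeightOneSpectrum (𝓞 K))
    (x : ι → AdeleRing (𝓞 K) K) (M : Matrix ι κ (AdeleRing (𝓞 K) K)) :
    vecFinHeight K v (x ᵥ* M) ≤
      (Finset.univ.sup fun ij : ι × κ => ‖(M ij.1 ij.2).2 v‖₊) * vecFinHeight K v x := by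
  refine vecFinHeight_le fun j => ?_
  have hsum : ((x ᵥ* M) j).2 v = ∑ i, (x i).2 v * (M i j).2 v := by
    rw [Matrix.vecMul_apply_eq_sum, ← AdelicGroupData.adeleEval_apply (K := K) v, map_sum]
    simp only [map_mul, AdelicGroupData.adeleEval_apply]
  rw [hsum]
  refine IsUltrametricDist.nnnorm_sum_le_of_forall_le fun i _ => ?_
  have h1 : ‖(M i j).2 v‖₊ ≤ Finset.univ.sup fun ij : ι × κ => ‖(M ij.1 ij.2).2 v‖₊ :=
    Finset.le_sup (f := fun ij : ι × κ => ‖(M ij.1 ij.2).2 v‖₊) (b := (i, j)) (Finset.mem_univ _)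
  have h2 : ‖(x i).2 v‖₊ ≤ vecFinHeight K v x := nnnorm_snd_apply_le_vecFinHeight v x i
  calc ‖(x i).2 v * (M i j).2 v‖₊ = ‖(M i j).2 v‖₊ * ‖(x i).2 v‖₊ := by rw [nnnorm_mul, mul_comm]
    _ ≤ (Finset.univ.sup fun ij : ι × κ => ‖(M ij.1 ij.2).2 v‖₊) * vecFinHeight K v x :=
        mul_le_mul' h1 h2

/-- If all entries of `M` are `v`-adic integers then `h_v(x M) ≤ h_v(x)`. [folklore] -/
theorem vecFinHeight_vecMul_le_of_forall_mem {κ : Type*} [Fintype κ] (v : HeightOneSpectrum (𝓞 K))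
    (x : ι → AdeleRing (𝓞 K) K) {M : Matrix ι κ (AdeleRing (𝓞 K) K)}
    (hM : ∀ i j, (M i j).2 v ∈ v.adicCompletionIntegers K) :
    vecFinHeight K v (x ᵥ* M) ≤ vecFinHeight K v x := by
  refine (vecFinHeight_vecMul_le v x M).trans ?_
  have h1 : (Finset.univ.sup fun ij : ι × κ => ‖(M ij.1 ij.2).2 v‖₊) ≤ 1 := by
    refine Finset.sup_le fun ij _ => ?_
    rw [← NNReal.coe_le_coe, coe_nnnorm, NNReal.coe_one]
    exact Valued.toNormedField.norm_le_one_iff.2 (hM ij.1 ij.2)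
  calc (Finset.univ.sup fun ij : ι × κ => ‖(M ij.1 ij.2).2 v‖₊) * vecFinHeight K v x
      ≤ 1 * vecFinHeight K v x := mul_le_mul' h1 le_rfl
    _ = vecFinHeight K v x := one_mul _

/-- **The finite local heights are invariant under `GL_n(𝒪_v)`**: if the `v`-components of all
entries of `g` and of `g⁻¹` are `v`-adic integers then `h_v(x g) = h_v(x)` (Garrett (2018),
§2.2: "the isometry groups of the height functions `h_v` are the compact subgroups `K_v`").
[cite: Garrett2018, §2.2 (PDF p. 81)] -/
theorem vecFinHeight_vecMul_eq_of_forall_mem [DecidableEq ι] (v : HeightOneSpectrum (𝓞 K))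
    (x : ι → AdeleRing (𝓞 K) K) (g : GL ι (AdeleRing (𝓞 K) K))
    (hg : ∀ i j, ((g : Matrix ι ι (AdeleRing (𝓞 K) K)) i j).2 v ∈ v.adicCompletionIntegers K)
    (hg' : ∀ i j, (((g⁻¹ : GL ι (AdeleRing (𝓞 K) K)) : Matrix ι ι (AdeleRing (𝓞 K) K)) i j).2 v ∈
      v.adicCompletionIntegers K) :
    vecFinHeight K v (x ᵥ* (g : Matrix ι ι (AdeleRing (𝓞 K) K))) = vecFinHeight K v x := by
  refine le_antisymm (vecFinHeight_vecMul_le_of_forall_mem v x hg) ?_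
  have h := vecFinHeight_vecMul_le_of_forall_mem v (x ᵥ* (g : Matrix ι ι (AdeleRing (𝓞 K) K))) hg'
  rwa [Matrix.vecMul_vecMul, ← Units.val_mul, mul_inv_cancel, Units.val_one, Matrix.vecMul_one]
    at h

/-! ### Rational vectors: height `≥ 1`, height-finiteness of primitive vectors -/

/-- At all but finitely many finite places, every coordinate of a rational vector is a `v`-adic
integer and some coordinate is a `v`-adic unit; hence `h_v(ξ) = 1` for almost all `v` when
`ξ ≠ 0`. [cite: Garrett2018, §2.2 (PDF p. 82)] -/
theorem eventually_vecFinHeight_principalVec_eq_one {ξ : ι → K} (hξ : ξ ≠ 0) :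
    ∀ᶠ v : HeightOneSpectrum (𝓞 K) in Filter.cofinite, vecFinHeight K v (principalVec K ξ) = 1 := by
  obtain ⟨i₀, hi₀⟩ : ∃ i, ξ i ≠ 0 := Function.ne_iff.mp hξ
  -- each coordinate has local norm `≤ 1` almost everywhere, and `= 1` if non-zero
  have hle : ∀ i, ∀ᶠ v : HeightOneSpectrum (𝓞 K) in Filter.cofinite,
      ‖(principalVec K ξ i).2 v‖₊ ≤ 1 := by
    intro i
    by_cases hi : ξ i = 0
    · refine Filter.Eventually.of_forall fun v => ?_
      rw [principalVec_apply, hi, map_zero, AdeleRing.zero_snd_apply, nnnorm_zero]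
      exact zero_le_one
    · have h := hasFiniteMulSupport_nnnorm K
        (Units.map (algebraMap K (AdeleRing (𝓞 K) K) : K →* _) (Units.mk0 _ hi))
      refine Filter.eventually_cofinite.2 (h.subset fun v hv => ?_)
      rw [Function.mem_mulSupport]
      exact fun h1 => hv (le_of_eq h1)
  have heq : ∀ᶠ v : HeightOneSpectrum (𝓞 K) in Filter.cofinite, ‖(principalVec K ξ i₀).2 v‖₊ = 1 := by
    have h := hasFiniteMulSupport_nnnorm K
      (Units.map (algebraMap K (AdeleRing (𝓞 K) K) : K →* _) (Units.mk0 _ hi₀))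
    exact Filter.eventually_cofinite.2 (h.subset fun v hv => hv)
  filter_upwards [Filter.eventually_all.2 hle, heq] with v hv hv₀
  refine le_antisymm (vecFinHeight_le hv) ?_
  rw [← hv₀]
  exact nnnorm_snd_apply_le_vecFinHeight v _ i₀

/-- A non-zero rational vector has finite height data. [folklore] -/
theorem isHeightFinite_principalVec {ξ : ι → K} (hξ : ξ ≠ 0) : IsHeightFinite K (principalVec K ξ) := by
  refine (Filter.eventually_cofinite.1 (eventually_vecFinHeight_principalVec_eq_one hξ)).subset ?_
  intro v hv
  exact hv

/-- **A non-zero rational vector has height at least `1`**: for a non-zero coordinate `ξ_{i₀}`,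
`h(ξ) ≥ ∏_v |ξ_{i₀}|_v = 1` by the product formula (Garrett (2018), §2.2, proof of Cor. 2.2.6:
"`h(c m₁ d) ≥ |c m₁| = |c| |m₁| = |m₁|` by the product rule, since `c ∈ kˣ`").
[cite: Garrett2018, §2.2 (PDF p. 84)] -/
theorem one_le_vecHeight_principalVec {ξ : ι → K} (hξ : ξ ≠ 0) : 1 ≤ vecHeight K (principalVec K ξ) := by
  obtain ⟨i₀, hi₀⟩ : ∃ i, ξ i ≠ 0 := Function.ne_iff.mp hξ
  set u : (AdeleRing (𝓞 K) K)ˣ :=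
    Units.map (algebraMap K (AdeleRing (𝓞 K) K) : K →* _) (Units.mk0 _ hi₀) with hu
  have hu1 : IdeleClassGroup.ideleNorm K u = 1 := ideleNorm_principal ⟨Units.mk0 _ hi₀, rfl⟩
  have hucoe : (u : AdeleRing (𝓞 K) K) = principalVec K ξ i₀ := rfl
  rw [← hu1, ideleNorm_apply, vecHeight, hucoe]
  refine mul_le_mul' (Finset.prod_le_prod' fun w _ => ?_) ?_
  · exact pow_le_pow_left' (nnnorm_fst_apply_le_vecArchNorm w _ i₀) _
  · refine finprod_le_finprod' ?_ (isHeightFinite_principalVec hξ) fun v => ?_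
    · rw [← hucoe]; exact hasFiniteMulSupport_nnnorm K u
    · exact nnnorm_snd_apply_le_vecFinHeight v _ i₀

/-- **Primitive vectors have finite height data**: for `ξ ∈ Kⁿ ∖ 0` and `g ∈ GL_n(𝔸_K)`,
`h_v(ξ g) = 1` for all but finitely many `v` — at almost all `v` the entries of `g_v` and `g_v⁻¹`
are integral, so `h_v(ξ g) = h_v(ξ) = 1` (Godement, Sém. Bourbaki 257, §1.1: for primitive `x`,
"for almost every finite `p`, the coordinates are `p`-adic integers prime among them"; Garrett
(2018), §3.3, PDF p. 162). [cite: Garrett2018, §3.3 (PDF p. 162)] -/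
theorem isHeightFinite_principalVec_vecMul [DecidableEq ι] {ξ : ι → K} (hξ : ξ ≠ 0)
    (g : GL ι (AdeleRing (𝓞 K) K)) :
    IsHeightFinite K (principalVec K ξ ᵥ* (g : Matrix ι ι (AdeleRing (𝓞 K) K))) := by
  have hg : ∀ᶠ v : HeightOneSpectrum (𝓞 K) in Filter.cofinite, ∀ ij : ι × ι,
      ((g : Matrix ι ι (AdeleRing (𝓞 K) K)) ij.1 ij.2).2 v ∈ v.adicCompletionIntegers K :=
    Filter.eventually_all.2 fun ij => ((g : Matrix ι ι (AdeleRing (𝓞 K) K)) ij.1 ij.2).2.2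
  have hg' : ∀ᶠ v : HeightOneSpectrum (𝓞 K) in Filter.cofinite, ∀ ij : ι × ι,
      (((g⁻¹ : GL ι (AdeleRing (𝓞 K) K)) : Matrix ι ι (AdeleRing (𝓞 K) K)) ij.1 ij.2).2 v ∈
        v.adicCompletionIntegers K :=
    Filter.eventually_all.2 fun ij =>
      ((((g⁻¹ : GL ι (AdeleRing (𝓞 K) K)) : Matrix ι ι (AdeleRing (𝓞 K) K)) ij.1 ij.2).2.2)
  have h : ∀ᶠ v : HeightOneSpectrum (𝓞 K) in Filter.cofinite,
      vecFinHeight K v (principalVec K ξ ᵥ* (g : Matrix ι ι (AdeleRing (𝓞 K) K))) = 1 := by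
    filter_upwards [hg, hg', eventually_vecFinHeight_principalVec_eq_one hξ] with v hv hv' h1
    rw [vecFinHeight_vecMul_eq_of_forall_mem v _ g (fun i j => hv (i, j)) (fun i j => hv' (i, j)), h1]
  exact (Filter.eventually_cofinite.1 h).subset fun v hv => hv

end Basic

end Literature.NumberTheory.Automorphic
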